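import Summits.QuantumFields.BalabanUV.T4Continuum.Support.NE7TopLandauGauge
import Summits.QuantumFields.BalabanUV.T4Continuum.Support.NE7TopLandauGradient
import Summits.QuantumFields.BalabanUV.T4Continuum.Support.NE7CovDivB8Letter
import Literature.MathematicalPhysics.QuantumFieldTheory.Balaban1983to89.B16Ineq382WilsonFactor
import HarnessLib

/-!
# NE7TopLandauLinks — ROAD v4, piece D5: BOTH LINK BINDERS OF G7 (`hr₀ = O(δ∕M)`, `hr₁ = O(M·j + ε)`) at a block-flat small-field configuration,
# from ONE remaining datum — lit-balaban's covariant divergence `B8Ineq132.covDiv 1 (U^u)` of the plaquette field bounded by `j` in every unitary periodic gauge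

Cell `pub-balaban`, rung (B)+1 sub-cell t4, lineage `b2b-balaban-t4-ne7-p1`, generation 74 (CRUX PROVER NE7 #1, OWNER row NE7).  Memo `REP-FLAT-ROAD-v4.md` §4.
COMPOSITION of D4 `NE7TopLandauGauge.exists_top_landau_gauge_flatTop` (the exact top Landau gauge `u₀`: links `≤ C₀Mε`, `log U^{u₀}` exactly gauged, straight datum
`≤ C₂Mε`) with T5 `NE7TopLandauGradient.exists_exact_gradient_const` (link gradient from the covariant plaquette current) and the `O(ε²)` comparison (§1) between T5's
raw current `Σ_ν cDstar W ν (W(∂p_{νκ}) − 1) x` and the PRINTED (1.2) `covDiv 1 W κ x` (R4 `NE7CovDivB8Letter.smul_covDiv_eq_tension_devForm`: the latter is the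
tension of the ANTISYMMETRISED deviation form; `W(∂p_{κν}) = W(∂p_{νκ})⁻¹` makes the two deviations agree to `‖W(∂p_{κν}) − 1‖·‖W(∂p_{νκ}) − 1‖ ≤ ε²`).

WHAT ([folklore]; 0 def, 0 sorry; every dimension `d + 1`, `n : Type` as in D4∕G7).
§1 **`norm_rawCurrent_sub_covDiv_le`** (the two orientations of a plaquette are inverse holonomies: lit-balaban `B16Ineq382.hol_plaqWord_swap`, BY NAME): `‖Σ_ν cDstar W ν (W(∂p_{νκ}) − 1) x − covDiv 1 W κ x‖ ≤ (d+1)·2ε²`.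
§2 **`exists_top_landau_links_flatTop`**: `∃ C₀ C₃ C₄ θ₂ > 0` (on `d`, `card n`, `L`) such that for all `k, N`, every unitary `(L^{k+1}N)`-periodic `U` with
   plaquettes `≤ ε`, `cavgIter L (k+1) U = flat`, `M²ε ≤ θ₂` (`M = L^{k+1}`), and `‖covDiv 1 (U^u) κ x‖ ≤ j` at every bond in every unitary periodic gauge `u`:
   there is a unitary periodic `u₀` with `‖U^{u₀}(y, κ) − 1‖ ≤ C₀·M·ε` (G7's `hr₀`, `= C₀δ∕M`) and `‖U^{u₀}(y + e_τ, κ) − U^{u₀}(y, κ)‖ ≤ C₃·M·j + C₄·ε` (G7's `hr₁`;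
   `= O(δ∕M²)` as soon as `j = O(δ∕M³)`, the size R4 `NE7CovDivB8Letter.norm_covDiv_le_of_tanCritical` gives at a tangent-critical configuration modulo the (160)
   docking constant `Λ`).
So REP♭⁻ (memo §9 of gen 72: the two link binders of G7 `NE7ApeTrivialFlatEndLinks.smallField_of_trivialLetters_links`) ⇐ [(1.9)-size bound on `covDiv 1 (U^u)`].

HONEST FRAMING (page 1): composition by name; the current bound `j` is a HYPOTHESIS here (R4 + (160) supply it at a tangent-critical configuration — not this
file); REP♭ NOT proved unconditionally; (APE) NOT proved; NOT NE7; spine 0∕9; finite T⁴ rung (B)+1 — NOT infinite volume, NOT mass gap, NOT Clay.  Continuum YM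
on T⁴ ⇐ BetaPertH ∧ nine spine estimates (0/9 proved); BetaPertH ⇐ (D1) ∧ (D4) ∧ CAP+tail; G-an2-4 gates asym, D1 and NE2/3/4.
-/

set_option autoImplicit false

open scoped BigOperators Matrix Matrix.Norms.L2Operator
open NormedSpace Finset

namespace Summit.QuantumFields.BalabanUV.T4Continuum.NE7TopLandauLinks

open Literature.MathematicalPhysics.QuantumFieldTheory.Balaban1983to89
open B7Prop1Explicit B7Prop2Explicit MatrixLog
open T4AveragingDeficitWall (Ad IsUnitaryCfg SmallField fhol)
open T4AveragingDeficitWallBoundary (IsPeriodicCfg)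
open T4AveragingDeficitNonAbelian (Ad_sub)
open AveragingDeficitTransport (norm_Ad_of_unitary)
open AveragingDeficitMultiLevelPrep (cavgIter)
open AveragingDeficitKDatum (isUnitaryCfg_gaugeAct)
open BlockAverageCurrent (smallField_gaugeAct)
open BlockAveragePushDirSplit (flat)
open NE3EnergyShapes (IsUnitarySite IsPeriodicSite)
open NE3SmoothLiftW (isPeriodicCfg_gaugeAct)
open NE3CovariantCalculus (cDstar)
open NE7ExpLogSecondOrder (real_exp_sub_one_le_two_mul)
open B8Ineq132 (covDiv)
open NE7CovDivB8Letter (exists_devForm smul_covDiv_eq_tension_devForm)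
open NE7TopLandauGauge (exists_top_landau_gauge_flatTop)
open NE7TopLandauGradient (exists_exact_gradient_const)

noncomputable section

variable {d : ℕ} {n : Type} [Fintype n] [DecidableEq n]

/-! ## §1 Raw versus antisymmetrised plaquette current: an `O(ε²)` comparison -/

section Compare

/-- **RAW VERSUS PRINTED CURRENT.**  For a unitary `W` with `ε`-small plaquettes, at every bond `(x, κ)`:
`‖Σ_ν cDstar W ν (W(∂p_{νκ}) − 1) x − covDiv 1 W κ x‖ ≤ (d+1)·2ε²` — (1.2) is the tension of the antisymmetrised deviation form (R4), which differs from the raw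
deviation only for `κ < ν`, by `−(W(∂p_{κν}) − 1)(W(∂p_{νκ}) − 1)`. [folklore] -/
theorem norm_rawCurrent_sub_covDiv_le {W : Site (d + 1) → Fin (d + 1) → (Matrix n n ℂ)ˣ} (hWu : IsUnitaryCfg W)
    {ε : ℝ} (hε : 0 ≤ ε) (hWε : SmallField W ε) (x : Site (d + 1)) (κ : Fin (d + 1)) :
    ‖(∑ ν : Fin (d + 1), cDstar W ν (fun w => ((hol W w (plaqWord ν κ) : (Matrix n n ℂ)ˣ) : Matrix n n ℂ) - 1) x) - covDiv 1 W κ x‖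
      ≤ ((d + 1 : ℕ) : ℝ) * (2 * ε ^ 2) := by
  obtain ⟨D, hDF, hDanti⟩ := exists_devForm W
  have hdic : covDiv 1 W κ x = ∑ ν : Fin (d + 1), cDstar W ν (fun w => D w ν κ) x := by
    rw [← one_smul ℝ (covDiv 1 W κ x)]
    exact smul_covDiv_eq_tension_devForm one_ne_zero hDF hDanti κ x
  -- the two deviations agree to `ε²`
  have hg : ∀ (w : Site (d + 1)) (ν : Fin (d + 1)), ‖(((hol W w (plaqWord ν κ) : (Matrix n n ℂ)ˣ) : Matrix n n ℂ) - 1) - D w ν κ‖ ≤ ε ^ 2 := by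
    intro w ν
    rcases lt_trichotomy ν κ with h | h | h
    · rw [hDF w ν κ h, show fhol W (w, ⟨(ν, κ), h⟩) = hol W w (plaqWord ν κ) from rfl, sub_self, norm_zero]
      positivity
    · subst h
      have hD0 : D w ν ν = 0 := by
        have h2 : (2 : ℂ) • D w ν ν = 0 := by
          rw [two_smul]
          nth_rewrite 1 [hDanti w ν ν]
          exact neg_add_cancel _
        exact (smul_eq_zero.mp h2).resolve_left two_ne_zero
      rw [hD0, sub_zero, B7Prop1Local.hol_plaqWord_eq, mul_inv_cancel_right, mul_inv_cancel, Units.val_one, sub_self, norm_zero]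
      positivity
    · rw [hDanti w κ ν, hDF w κ ν h, show fhol W (w, ⟨(κ, ν), h⟩) = hol W w (plaqWord κ ν) from rfl]
      have hQP : ((hol W w (plaqWord κ ν) : (Matrix n n ℂ)ˣ) : Matrix n n ℂ) * ((hol W w (plaqWord ν κ) : (Matrix n n ℂ)ˣ) : Matrix n n ℂ) = 1 := by
        rw [← Units.val_mul, B16Ineq382.hol_plaqWord_swap W w κ ν, mul_inv_cancel, Units.val_one]
      have hid : (((hol W w (plaqWord ν κ) : (Matrix n n ℂ)ˣ) : Matrix n n ℂ) - 1) - -(((hol W w (plaqWord κ ν) : (Matrix n n ℂ)ˣ) : Matrix n n ℂ) - 1)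
          = -((((hol W w (plaqWord κ ν) : (Matrix n n ℂ)ˣ) : Matrix n n ℂ) - 1) * (((hol W w (plaqWord ν κ) : (Matrix n n ℂ)ˣ) : Matrix n n ℂ) - 1)) := by
        rw [sub_mul, mul_sub, hQP, one_mul, mul_one]
        abel
      rw [hid, norm_neg, pow_two]
      exact (norm_mul_le _ _).trans (mul_le_mul (hWε w κ ν h.ne) (hWε w ν κ h.ne') (norm_nonneg _) hε)
  rw [hdic, ← Finset.sum_sub_distrib]
  have hν : ∀ ν : Fin (d + 1),
      ‖cDstar W ν (fun w => ((hol W w (plaqWord ν κ) : (Matrix n n ℂ)ˣ) : Matrix n n ℂ) - 1) x - cDstar W ν (fun w => D w ν κ) x‖ ≤ 2 * ε ^ 2 := by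
    intro ν
    have hlin : cDstar W ν (fun w => ((hol W w (plaqWord ν κ) : (Matrix n n ℂ)ˣ) : Matrix n n ℂ) - 1) x - cDstar W ν (fun w => D w ν κ) x
        = Ad (W (x - e ν) ν)⁻¹ (((((hol W (x - e ν) (plaqWord ν κ) : (Matrix n n ℂ)ˣ) : Matrix n n ℂ) - 1) - D (x - e ν) ν κ))
          - (((((hol W x (plaqWord ν κ) : (Matrix n n ℂ)ˣ) : Matrix n n ℂ) - 1) - D x ν κ)) := by
      simp only [cDstar, Ad_sub]
      abel
    rw [hlin]
    refine (norm_sub_le _ _).trans ?_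
    rw [norm_Ad_of_unitary ((unitaryUnits (Matrix n n ℂ)).inv_mem (hWu _ ν))]
    linarith [hg (x - e ν) ν, hg x ν]
  calc _ ≤ ∑ ν : Fin (d + 1), 2 * ε ^ 2 := norm_sum_le_of_le _ fun ν _ => hν ν
    _ = ((d + 1 : ℕ) : ℝ) * (2 * ε ^ 2) := by rw [Finset.sum_const, Finset.card_univ, Fintype.card_fin, nsmul_eq_mul]

end Compare

/-! ## §2 Both link binders of G7 at a block-flat small-field configuration, from the printed current -/

section Links

/-- **D5, THE TWO LINK BINDERS OF G7 FROM THE PRINTED CURRENT.**  `∃ C₀ C₃ C₄ θ₂ > 0` (on `d`, `card n`, `L`): for all `k, N`, every unitary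
`(L^{k+1}N)`-periodic `U` with `ε`-small plaquettes, `cavgIter L (k+1) U = flat` and `M²ε ≤ θ₂` (`M = L^{k+1}`), if `‖covDiv 1 (U^u) κ x‖ ≤ j` at every bond in every
unitary periodic gauge `u`, then some unitary periodic `u₀` has `‖U^{u₀}(y, κ) − 1‖ ≤ C₀·M·ε` and `‖U^{u₀}(y + e_τ, κ) − U^{u₀}(y, κ)‖ ≤ C₃·M·j + C₄·ε`. [folklore] -/
theorem exists_top_landau_links_flatTop [Nonempty n] {L : ℕ} (hL : 2 ≤ L) :
    ∃ C₀ C₃ C₄ θ₂ : ℝ, 0 < C₀ ∧ 0 < C₃ ∧ 0 < C₄ ∧ 0 < θ₂ ∧ ∀ (k N : ℕ) [NeZero N] [NeZero (L ^ (k + 1))]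
      (U : Site (d + 1) → Fin (d + 1) → (Matrix n n ℂ)ˣ) (ε j : ℝ),
      IsUnitaryCfg U → 0 ≤ ε → SmallField U ε → IsPeriodicCfg U ((L ^ (k + 1) * N : ℕ) : ℤ) → cavgIter L (k + 1) U = flat →
      ((L : ℝ) ^ (k + 1)) ^ 2 * ε ≤ θ₂ →
      (∀ u : Site (d + 1) → (Matrix n n ℂ)ˣ, IsUnitarySite u → IsPeriodicSite u ((L ^ (k + 1) * N : ℕ) : ℤ) →
        ∀ (x : Site (d + 1)) (κ : Fin (d + 1)), ‖covDiv 1 (gaugeAct u U) κ x‖ ≤ j) →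
      ∃ u₀ : Site (d + 1) → (Matrix n n ℂ)ˣ, IsUnitarySite u₀ ∧ IsPeriodicSite u₀ ((L ^ (k + 1) * N : ℕ) : ℤ) ∧
        (∀ (y : Site (d + 1)) (κ : Fin (d + 1)), ‖((gaugeAct u₀ U y κ : (Matrix n n ℂ)ˣ) : Matrix n n ℂ) - 1‖ ≤ C₀ * (L : ℝ) ^ (k + 1) * ε) ∧
        (∀ (y : Site (d + 1)) (κ τ : Fin (d + 1)),
          ‖((gaugeAct u₀ U (y + e τ) κ : (Matrix n n ℂ)ˣ) : Matrix n n ℂ) - ((gaugeAct u₀ U y κ : (Matrix n n ℂ)ˣ) : Matrix n n ℂ)‖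
            ≤ C₃ * (L : ℝ) ^ (k + 1) * j + C₄ * ε) := by
  obtain ⟨C₀, C₁, C₂, θ₁, hC₀, hC₁, hC₂, hθ₁, hD4⟩ := exists_top_landau_gauge_flatTop (d := d) (n := n) hL
  obtain ⟨K, hK, hT5⟩ := exists_exact_gradient_const (d := d) (n := n)
  obtain ⟨D, hDdef⟩ : ∃ D : ℝ, D = ((d + 1 : ℕ) : ℝ) := ⟨_, rfl⟩
  have hD1 : 1 ≤ D := by rw [hDdef]; exact_mod_cast Nat.succ_le_succ (Nat.zero_le d)
  have hD0 : 0 ≤ D := by linarith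
  obtain ⟨θ₂, hθ₂⟩ : ∃ θ₂ : ℝ, θ₂ = min θ₁ (1 / (128 * K * C₀ * D + 8 * C₀ + 1)) := ⟨_, rfl⟩
  have hden : 0 < 128 * K * C₀ * D + 8 * C₀ + 1 := by positivity
  have hθ₂0 : 0 < θ₂ := by rw [hθ₂]; exact lt_min hθ₁ (by positivity)
  have hθ₂1 : θ₂ ≤ θ₁ := by rw [hθ₂]; exact min_le_left _ _
  have hθ₂2 : θ₂ ≤ 1 / (128 * K * C₀ * D + 8 * C₀ + 1) := by rw [hθ₂]; exact min_le_right _ _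
  have hθ₂le1 : θ₂ ≤ 1 := hθ₂2.trans (by
    rw [div_le_one hden]
    have : 0 ≤ 128 * K * C₀ * D + 8 * C₀ := by positivity
    linarith)
  refine ⟨C₀, 4 * K, 4 * K * (2 * D * (1 + C₀) + C₂), θ₂, hC₀, by positivity, by positivity, hθ₂0,
    fun k N _ _ U ε j hU hε hUε hUP hflat hsmall hJ => ?_⟩
  -- the scale
  have hL1 : (1 : ℝ) ≤ L := by exact_mod_cast (show 1 ≤ L by omega)
  set M : ℝ := (L : ℝ) ^ (k + 1) with hM
  have hM1 : 1 ≤ M := one_le_pow₀ hL1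
  have hM0 : 0 < M := by linarith
  have hMcast : (((L ^ (k + 1) : ℕ) : ℝ)) = M := by rw [hM, Nat.cast_pow]
  have hMε : M * ε ≤ θ₂ := by nlinarith [hsmall, hM1, hε]
  have hj0 : 0 ≤ j := (norm_nonneg _).trans (hJ 1 (fun _ => (unitaryUnits (Matrix n n ℂ)).one_mem) (fun _ _ => rfl) 0 0)
  -- D4: the exact top Landau gauge
  obtain ⟨u₀, hu₀, hu₀P, hlinks, hgauge, -, hstraight⟩ := hD4 k N U ε hU hε hUε hUP hflat (hsmall.trans hθ₂1)
  refine ⟨u₀, hu₀, hu₀P, hlinks, ?_⟩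
  -- T5's data for `W = U^{u₀}`
  have hWu : IsUnitaryCfg (gaugeAct u₀ U) := isUnitaryCfg_gaugeAct hu₀ hU
  have hWP : IsPeriodicCfg (gaugeAct u₀ U) ((L ^ (k + 1) * N : ℕ) : ℤ) := isPeriodicCfg_gaugeAct hu₀P hUP
  have hWε : SmallField (gaugeAct u₀ U) ε := smallField_gaugeAct hu₀ hUε
  have hr8 : C₀ * (L : ℝ) ^ (k + 1) * ε ≤ 1 / 8 := by
    rw [← hM]
    have h1 : C₀ * M * ε ≤ C₀ * θ₂ := by rw [mul_assoc]; exact mul_le_mul_of_nonneg_left hMε hC₀.le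
    have h2 : C₀ * θ₂ ≤ C₀ * (1 / (128 * K * C₀ * D + 8 * C₀ + 1)) := mul_le_mul_of_nonneg_left hθ₂2 hC₀.le
    have h3 : C₀ * (1 / (128 * K * C₀ * D + 8 * C₀ + 1)) ≤ 1 / 8 := by
      rw [mul_one_div, div_le_div_iff₀ hden (by norm_num : (0 : ℝ) < 8)]
      have : 0 ≤ 128 * K * C₀ * D := by positivity
      linarith
    linarith
  have hcur : ∀ (x : Site (d + 1)) (κ : Fin (d + 1)),
      ‖∑ ν : Fin (d + 1), cDstar (gaugeAct u₀ U) ν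
          (fun w => ((hol (gaugeAct u₀ U) w (plaqWord ν κ) : (Matrix n n ℂ)ˣ) : Matrix n n ℂ) - 1) x‖ ≤ j + D * (2 * ε ^ 2) := by
    intro x κ
    have h1 := norm_rawCurrent_sub_covDiv_le hWu hε hWε x κ
    have h2 := norm_le_norm_add_norm_sub' (∑ ν : Fin (d + 1), cDstar (gaugeAct u₀ U) ν
      (fun w => ((hol (gaugeAct u₀ U) w (plaqWord ν κ) : (Matrix n n ℂ)ˣ) : Matrix n n ℂ) - 1) x) (covDiv 1 (gaugeAct u₀ U) κ x)
    rw [hDdef]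
    linarith [hJ u₀ hu₀ hu₀P x κ]
  have hsmallT5 : K * ((d + 1 : ℕ) : ℝ) * (((L ^ (k + 1) : ℕ) : ℝ)) * (Real.exp (8 * (C₀ * (L : ℝ) ^ (k + 1) * ε)) - 1) ≤ 1 / 8 := by
    rw [hMcast, ← hDdef, ← hM]
    have hr0 : 0 ≤ C₀ * M * ε := by positivity
    have hexp : Real.exp (8 * (C₀ * M * ε)) - 1 ≤ 2 * (8 * (C₀ * M * ε)) :=
      real_exp_sub_one_le_two_mul (by positivity) (by rw [← hM] at hr8; linarith)
    have h1 : K * D * M * (Real.exp (8 * (C₀ * M * ε)) - 1) ≤ K * D * M * (2 * (8 * (C₀ * M * ε))) :=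
      mul_le_mul_of_nonneg_left hexp (by positivity)
    have h2 : K * D * M * (2 * (8 * (C₀ * M * ε))) = 16 * K * C₀ * D * (M ^ 2 * ε) := by ring
    have h3 : 16 * K * C₀ * D * (M ^ 2 * ε) ≤ 16 * K * C₀ * D * θ₂ := mul_le_mul_of_nonneg_left (by rw [hM]; exact hsmall) (by positivity)
    have h4 : 16 * K * C₀ * D * θ₂ ≤ 16 * K * C₀ * D * (1 / (128 * K * C₀ * D + 8 * C₀ + 1)) := mul_le_mul_of_nonneg_left hθ₂2 (by positivity)
    have h5 : 16 * K * C₀ * D * (1 / (128 * K * C₀ * D + 8 * C₀ + 1)) ≤ 1 / 8 := by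
      rw [mul_one_div, div_le_div_iff₀ hden (by norm_num : (0 : ℝ) < 8)]
      have : 0 ≤ 8 * C₀ := by positivity
      linarith
    linarith
  obtain ⟨-, hgrad⟩ := hT5 (L ^ (k + 1)) N (gaugeAct u₀ U) ε (C₀ * (L : ℝ) ^ (k + 1) * ε) (C₂ * (L : ℝ) ^ (k + 1) * ε) (j + D * (2 * ε ^ 2))
    hWu hWP hε hWε hlinks hr8 hgauge hstraight hcur hsmallT5
  -- arithmetic: `4K(M(j + D·2ε² + D·2rε) + q/M) ≤ 4K·M·j + 4K(2D(1 + C₀) + C₂)·ε`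
  intro y κ τ
  refine (hgrad y κ τ).trans ?_
  rw [hMcast, ← hDdef, ← hM]
  have hq : C₂ * M * ε / M = C₂ * ε := by field_simp
  rw [hq]
  have e1 : M * ε ^ 2 ≤ ε := by
    have : M * ε ^ 2 = (M * ε) * ε := by ring
    rw [this]
    have h := mul_le_mul_of_nonneg_right (hMε.trans hθ₂le1) hε
    linarith
  have e2 : M * (M * ε) * ε ≤ ε := by
    have : M * (M * ε) * ε = (M ^ 2 * ε) * ε := by ring
    rw [this]
    have h := mul_le_mul_of_nonneg_right ((show M ^ 2 * ε ≤ θ₂ by rw [hM]; exact hsmall).trans hθ₂le1) hε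
    linarith
  have h1 : M * (j + D * (2 * ε ^ 2) + D * (2 * (C₀ * M * ε) * ε)) + C₂ * ε
      = M * j + 2 * D * (M * ε ^ 2) + 2 * D * C₀ * (M * (M * ε) * ε) + C₂ * ε := by ring
  rw [h1]
  have h2 : 2 * D * (M * ε ^ 2) ≤ 2 * D * ε := mul_le_mul_of_nonneg_left e1 (by positivity)
  have h3 : 2 * D * C₀ * (M * (M * ε) * ε) ≤ 2 * D * C₀ * ε := mul_le_mul_of_nonneg_left e2 (by positivity)
  nlinarith [hK.le, h2, h3, hj0, hM0.le]

end Links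

end

end Summit.QuantumFields.BalabanUV.T4Continuum.NE7TopLandauLinks
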